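import Literature.MathematicalPhysics.QuantumManyBody.OnsagerInequality
import HarnessLib

/-!
# Point charges in a positive-type subordinated kernel: `U_K ≥ -½ K(0) ∑ cᵢ²`

Topic `Literature/MathematicalPhysics/QuantumManyBody` (electrostatics groundwork for the charged
Bose gas, `JelliumBoseGas.foldyLaw`; continuation of `OnsagerInequality.lean`). In the Lieb–Solovej
lower bound the Coulomb kernel is cut off at long and short distances [LiebSolovej2001, §4]: the
Yukawa kernel `Y_{ω/ℓ}` produced by the sliding localization is replaced by
`V_R = Y_{R⁻¹}` and the error kernel `K = Y_{ω/ℓ} - V_R` is "positive semi-definite … Note,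
moreover, that `(Y_{ω/ℓ} - V_R)(0) = R⁻¹ - ω/ℓ ≤ R⁻¹`. Thus" the jellium energy of the `n`
(smeared-out-by-`χ`) point charges and the background in the kernel `K` is `≥ -½ n K(0)`
[LiebSolovej2001, (4.3)]. This file proves that mechanism for the kernels the tree can handle
explicitly: SUBORDINATED kernels `K_w(z) = ∫₀^∞ w(s) G_s(z) ds` with a measurable weight
`w ≥ 0` of finite `K_w(0) = ∫₀^∞ w(s) (4πs)^{-3/2} ds` (`G_s` the heat kernel of `ℝ³`; the
difference of two Yukawa kernels is `w(s) = 4π(e^{-a²s} - e^{-b²s})`, `YukawaSubordination.lean`),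
and for POINT charges `cᵢ` at `xᵢ` together with a background density `g ∈ L¹(ℝ³)`:

**`0 ≤ ∑ᵢ∑ⱼ cᵢcⱼ K_w(xᵢ - xⱼ) - 2∑ᵢ cᵢ ∫ g(y) K_w(xᵢ - y) dy + ∬ g(x) g(y) K_w(x - y) dx dy`**, hence
**`∑_{i<j} cᵢcⱼ K_w(xᵢ - xⱼ) - ∑ᵢ cᵢ ∫ g K_w(xᵢ - ·) + ½∬ g g K_w ≥ -½ K_w(0) ∑ᵢ cᵢ²`.**

Proof: for each `s > 0` the Gaussian form of the signed density `f_t = ∑ᵢ cᵢ G_t(· - xᵢ) - g`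
is nonnegative (`Coulomb.integral_prod_gaussian_nonneg`, i.e. `∬ f f G_s = ∫ e^{-4π²s|p|²}|f̂|² ≥ 0`);
by the semigroup law it equals `∑ᵢⱼ cᵢcⱼ G_{s+2t}(xᵢ - xⱼ) - 2∑ᵢ cᵢ ∫ g G_{s+t}(xᵢ - ·) + ∬ g g G_s`;
let `t → 0⁺` (dominated convergence), then integrate against `w(s) ds` (Fubini; everything is
absolutely convergent because `K_w(0) < ∞`). No distinctness of the points is needed.

* `Coulomb.integrable_prod_mul_gaussian`, `gaussianForm_symm`,
  `integral_prod_gaussian_gaussian_gaussian` (`∬ G_t(x-a)G_t(y-b)G_s(x-y) = G_{s+2t}(a-b)`),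
  `integral_prod_gaussian_mul_gaussian` (`∬ G_t(x-a) g(y) G_s(x-y) = ∫ g G_{s+t}(a-·)`).
* `Coulomb.gaussianForm_clouds_nonneg`, `continuousAt_heatKernel_left`, `tendsto_heatKernel_add`,
  `tendsto_integral_mul_heatKernel_add`, `gaussianForm_points_nonneg` — the Gaussian form with
  point charges: `0 ≤ ∑ᵢⱼ cᵢcⱼ G_s(xᵢ - xⱼ) - 2∑ᵢ cᵢ ∫ g G_s(xᵢ - ·) + ∬ g g G_s`.
* `Coulomb.integrableOn_weight_mul_heatKernel`, `subordinatedKernel_nonneg'`,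
  `subordinatedKernel_le_zero` — `0 ≤ K_w(z) ≤ K_w(0)`.
* `Coulomb.subordinated_points_nonneg` — the first display;
  `Coulomb.subordinated_points_ge` — **the second display** ([LiebSolovej2001, (4.3)] for
  subordinated kernels).

## References

* [LiebSolovej2001] E. H. Lieb, J. P. Solovej, Commun. Math. Phys. 217 (2001) 127–163, §4,
  (4.1)–(4.3) (arXiv:cond-mat/0007425, p. 10).
* [LiebLoss2001] E. H. Lieb, M. Loss, *Analysis*, 2nd ed. (2001), Thm. 9.8.
* [LiebSeiringer2009] E. H. Lieb, R. Seiringer, *The Stability of Matter in Quantum Mechanics*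
  (2010), Thm. 5.1, Lemma 6.1.
-/

noncomputable section

open MeasureTheory Set Filter Real
open scoped ENNReal NNReal Topology
open Literature.Analysis.UnboundedOperators

namespace Literature.MathematicalPhysics.QuantumManyBody.Coulomb

open BoseGas

/-! ### Mixed Gaussian forms -/

/-- For `φ, g ∈ L¹(ℝ³)` real measurable and `s > 0`, `(x, y) ↦ φ(x) g(y) G_s(x - y)` is integrable
on `ℝ³ × ℝ³` (the heat kernel is bounded by `(4πs)^{-3/2}`). [folklore] -/
theorem integrable_prod_mul_gaussian {φ g : Space → ℝ} (hφm : Measurable φ) (hφ : Integrable φ)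
    (hgm : Measurable g) (hg : Integrable g) {s : ℝ} (hs : 0 < s) :
    Integrable (fun z : Space × Space => φ z.1 * g z.2 * heatKernel s (z.1 - z.2))
      (volume.prod volume) := by
  have hKm : Measurable fun z : Space × Space => φ z.1 * g z.2 * heatKernel s (z.1 - z.2) :=
    ((hφm.comp measurable_fst).mul (hgm.comp measurable_snd)).mul
      ((continuous_heatKernel s).measurable.comp (measurable_fst.sub measurable_snd))
  have hb : Integrable (fun z : Space × Space => ‖φ z.1‖ * (‖g z.2‖ * (4 * π * s) ^ (-(3 : ℝ) / 2)))
      (volume.prod volume) := hφ.norm.mul_prod (hg.norm.mul_const _)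
  refine hb.mono' hKm.aestronglyMeasurable (Eventually.of_forall fun z => ?_)
  rw [Real.norm_eq_abs, abs_mul, abs_mul, abs_of_pos (heatKernel_pos hs _), mul_assoc,
    ← Real.norm_eq_abs, ← Real.norm_eq_abs]
  gcongr
  exact heatKernel_le_three hs _

/-- Symmetry of the Gaussian form: `∬ g(x) φ(y) G_s(x - y) = ∬ φ(x) g(y) G_s(x - y)`. [folklore] -/
theorem gaussianForm_symm (φ g : Space → ℝ) (s : ℝ) :
    ∫ z : Space × Space, g z.1 * φ z.2 * heatKernel s (z.1 - z.2) ∂(volume.prod volume) =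
      ∫ z : Space × Space, φ z.1 * g z.2 * heatKernel s (z.1 - z.2) ∂(volume.prod volume) := by
  rw [← integral_prod_swap (fun z : Space × Space => φ z.1 * g z.2 * heatKernel s (z.1 - z.2))]
  refine integral_congr_ae (Eventually.of_forall fun z => ?_)
  simp only [Prod.fst_swap, Prod.snd_swap]
  rw [← heatKernel_neg, neg_sub]
  ring

/-- **Two clouds in a Gaussian kernel**: `∬ G_t(x - a) G_t(y - b) G_s(x - y) dx dy = G_{s+2t}(a - b)`
(semigroup law twice). [folklore] -/
theorem integral_prod_gaussian_gaussian_gaussian {s t : ℝ} (hs : 0 < s) (ht : 0 < t) (a b : Space) :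
    ∫ z : Space × Space, heatKernel t (z.1 - a) * heatKernel t (z.2 - b) * heatKernel s (z.1 - z.2)
        ∂(volume.prod volume) = heatKernel (s + 2 * t) (a - b) := by
  have hGm : ∀ b : Space, Measurable fun x : Space => heatKernel t (x - b) := fun b =>
    (continuous_heatKernel t).measurable.comp (measurable_id.sub measurable_const)
  have hGi : ∀ b : Space, Integrable fun x : Space => heatKernel t (x - b) := fun b =>
    (integrable_heatKernel_holds (E := Space) ht).comp_sub_right b
  have hint := integrable_prod_mul_gaussian (hGm a) (hGi a) (hGm b) (hGi b) hs
  rw [integral_prod _ hint]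
  have hinner : ∀ x : Space,
      ∫ y, heatKernel t (x - a) * heatKernel t (y - b) * heatKernel s (x - y) =
        heatKernel t (x - a) * heatKernel (s + t) (x - b) := by
    intro x
    have h1 : (fun y => heatKernel t (x - a) * heatKernel t (y - b) * heatKernel s (x - y)) =
        fun y => heatKernel t (x - a) * (heatKernel s (x - y) * heatKernel t (y - b)) := by
      funext y
      ring
    rw [h1, integral_const_mul, integral_heatKernel_sub_mul_heatKernel_sub hs ht x b]
  have hst : 0 < s + t := by linarith
  calc ∫ x, ∫ y, (fun z : Space × Space =>
          heatKernel t (z.1 - a) * heatKernel t (z.2 - b) * heatKernel s (z.1 - z.2)) (x, y)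
      = ∫ x, heatKernel t (x - a) * heatKernel (s + t) (x - b) :=
        integral_congr_ae (Eventually.of_forall fun x => hinner x)
    _ = heatKernel (t + (s + t)) (a - b) := integral_heatKernel_sub_mul_heatKernel_sub' ht hst a b
    _ = heatKernel (s + 2 * t) (a - b) := by ring_nf

/-- **A cloud and a background in a Gaussian kernel**: for `g ∈ L¹(ℝ³)`,
`∬ G_t(x - a) g(y) G_s(x - y) dx dy = ∫ g(y) G_{s+t}(a - y) dy`. [folklore] -/
theorem integral_prod_gaussian_mul_gaussian {s t : ℝ} (hs : 0 < s) (ht : 0 < t) (a : Space)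
    {g : Space → ℝ} (hgm : Measurable g) (hg : Integrable g) :
    ∫ z : Space × Space, heatKernel t (z.1 - a) * g z.2 * heatKernel s (z.1 - z.2)
        ∂(volume.prod volume) = ∫ y, g y * heatKernel (s + t) (a - y) := by
  have hGm : Measurable fun x : Space => heatKernel t (x - a) :=
    (continuous_heatKernel t).measurable.comp (measurable_id.sub measurable_const)
  have hGi : Integrable fun x : Space => heatKernel t (x - a) :=
    (integrable_heatKernel_holds (E := Space) ht).comp_sub_right a
  have hint := integrable_prod_mul_gaussian hGm hGi hgm hg hs
  rw [integral_prod_symm _ hint]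
  refine integral_congr_ae (Eventually.of_forall fun y => ?_)
  show ∫ x, heatKernel t (x - a) * g y * heatKernel s (x - y) = g y * heatKernel (s + t) (a - y)
  have h1 : (fun x => heatKernel t (x - a) * g y * heatKernel s (x - y)) =
      fun x => g y * (heatKernel t (x - a) * heatKernel s (x - y)) := by
    funext x
    ring
  rw [h1, integral_const_mul, integral_heatKernel_sub_mul_heatKernel_sub' ht hs a y,
    show t + s = s + t from add_comm t s]

/-! ### The Gaussian form of point charges and a background -/

/-- **Clouds and background in a Gaussian kernel**: for charges `cᵢ ∈ ℝ` at `xᵢ ∈ ℝ³`, `s, t > 0`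
and a real measurable `g ∈ L¹(ℝ³)`,
`0 ≤ ∑ᵢ∑ⱼ cᵢcⱼ G_{s+2t}(xᵢ - xⱼ) - 2∑ᵢ cᵢ ∫ g(y) G_{s+t}(xᵢ - y) dy + ∬ g(x) g(y) G_s(x - y)`:
the Gaussian form `∬ f f G_s ≥ 0` (`integral_prod_gaussian_nonneg`) of
`f = ∑ᵢ cᵢ G_t(· - xᵢ) - g`, expanded with the semigroup law. [cite: LiebLoss2001, Thm. 9.8] -/
theorem gaussianForm_clouds_nonneg {N : ℕ} (c : Fin N → ℝ) (X : Fin N → Space) {s t : ℝ}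
    (hs : 0 < s) (ht : 0 < t) {g : Space → ℝ} (hgm : Measurable g) (hg : Integrable g) :
    0 ≤ (∑ i, ∑ j, c i * c j * heatKernel (s + 2 * t) (X i - X j)) -
        2 * (∑ i, c i * ∫ y, g y * heatKernel (s + t) (X i - y)) +
        ∫ z : Space × Space, g z.1 * g z.2 * heatKernel s (z.1 - z.2) ∂(volume.prod volume) := by
  set φ : Space → ℝ := fun x => ∑ i, c i * heatKernel t (x - X i) with hφ
  have hGm : ∀ b : Space, Measurable fun x : Space => heatKernel t (x - b) := fun b =>
    (continuous_heatKernel t).measurable.comp (measurable_id.sub measurable_const)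
  have hGi : ∀ b : Space, Integrable fun x : Space => heatKernel t (x - b) := fun b =>
    (integrable_heatKernel_holds (E := Space) ht).comp_sub_right b
  have hφm : Measurable φ := Finset.measurable_sum _ fun i _ => (hGm (X i)).const_mul _
  have hφi : Integrable φ := integrable_finsetSum _ fun i _ => (hGi (X i)).const_mul _
  -- cloud–cloud
  have hGG : ∀ i j, Integrable (fun z : Space × Space =>
      c i * heatKernel t (z.1 - X i) * (c j * heatKernel t (z.2 - X j)) * heatKernel s (z.1 - z.2))
        (volume.prod volume) ∧
      ∫ z : Space × Space, c i * heatKernel t (z.1 - X i) * (c j * heatKernel t (z.2 - X j)) *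
          heatKernel s (z.1 - z.2) ∂(volume.prod volume) =
        c i * c j * heatKernel (s + 2 * t) (X i - X j) := by
    intro i j
    have he : (fun z : Space × Space =>
        c i * heatKernel t (z.1 - X i) * (c j * heatKernel t (z.2 - X j)) * heatKernel s (z.1 - z.2)) =
        fun z => (c i * c j) *
          (heatKernel t (z.1 - X i) * heatKernel t (z.2 - X j) * heatKernel s (z.1 - z.2)) := by
      funext z
      ring
    rw [he]
    refine ⟨(integrable_prod_mul_gaussian (hGm _) (hGi _) (hGm _) (hGi _) hs).const_mul _, ?_⟩
    rw [integral_const_mul, integral_prod_gaussian_gaussian_gaussian hs ht]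
  -- cloud–background
  have hGg : ∀ i, Integrable (fun z : Space × Space =>
      c i * heatKernel t (z.1 - X i) * g z.2 * heatKernel s (z.1 - z.2)) (volume.prod volume) ∧
      ∫ z : Space × Space, c i * heatKernel t (z.1 - X i) * g z.2 * heatKernel s (z.1 - z.2)
          ∂(volume.prod volume) = c i * ∫ y, g y * heatKernel (s + t) (X i - y) := by
    intro i
    have he : (fun z : Space × Space =>
        c i * heatKernel t (z.1 - X i) * g z.2 * heatKernel s (z.1 - z.2)) =
        fun z => c i * (heatKernel t (z.1 - X i) * g z.2 * heatKernel s (z.1 - z.2)) := by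
      funext z
      ring
    rw [he]
    refine ⟨(integrable_prod_mul_gaussian (hGm _) (hGi _) hgm hg hs).const_mul _, ?_⟩
    rw [integral_const_mul, integral_prod_gaussian_mul_gaussian hs ht (X i) hgm hg]
  -- the pieces of the form of `φ - g`
  have hexp_φφ : (fun z : Space × Space => φ z.1 * φ z.2 * heatKernel s (z.1 - z.2)) =
      fun z => ∑ i, ∑ j, c i * heatKernel t (z.1 - X i) * (c j * heatKernel t (z.2 - X j)) *
        heatKernel s (z.1 - z.2) := by
    funext z
    simp only [hφ]
    rw [Finset.sum_mul_sum, Finset.sum_mul]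
    refine Finset.sum_congr rfl fun i _ => ?_
    rw [Finset.sum_mul]
  have hexp_φg : (fun z : Space × Space => φ z.1 * g z.2 * heatKernel s (z.1 - z.2)) =
      fun z => ∑ i, c i * heatKernel t (z.1 - X i) * g z.2 * heatKernel s (z.1 - z.2) := by
    funext z
    simp only [hφ]
    rw [Finset.sum_mul, Finset.sum_mul]
  have hφφ_int : Integrable (fun z : Space × Space => φ z.1 * φ z.2 * heatKernel s (z.1 - z.2))
      (volume.prod volume) := by
    rw [hexp_φφ]
    exact integrable_finsetSum _ fun i _ => integrable_finsetSum _ fun j _ => (hGG i j).1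
  have hφg_int : Integrable (fun z : Space × Space => φ z.1 * g z.2 * heatKernel s (z.1 - z.2))
      (volume.prod volume) := by
    rw [hexp_φg]
    exact integrable_finsetSum _ fun i _ => (hGg i).1
  have hgφ_int : Integrable (fun z : Space × Space => g z.1 * φ z.2 * heatKernel s (z.1 - z.2))
      (volume.prod volume) := integrable_prod_mul_gaussian hgm hg hφm hφi hs
  have hgg_int : Integrable (fun z : Space × Space => g z.1 * g z.2 * heatKernel s (z.1 - z.2))
      (volume.prod volume) := integrable_prod_mul_gaussian hgm hg hgm hg hs
  have hφφ_val : ∫ z : Space × Space, φ z.1 * φ z.2 * heatKernel s (z.1 - z.2) ∂(volume.prod volume) =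
      ∑ i, ∑ j, c i * c j * heatKernel (s + 2 * t) (X i - X j) := by
    rw [hexp_φφ, integral_finsetSum _ (fun i _ =>
      integrable_finsetSum _ fun j _ => (hGG i j).1)]
    refine Finset.sum_congr rfl fun i _ => ?_
    rw [integral_finsetSum _ (fun j _ => (hGG i j).1)]
    exact Finset.sum_congr rfl fun j _ => (hGG i j).2
  have hφg_val : ∫ z : Space × Space, φ z.1 * g z.2 * heatKernel s (z.1 - z.2) ∂(volume.prod volume) =
      ∑ i, c i * ∫ y, g y * heatKernel (s + t) (X i - y) := by
    rw [hexp_φg, integral_finsetSum _ (fun i _ => (hGg i).1)]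
    exact Finset.sum_congr rfl fun i _ => (hGg i).2
  have hgφ_val : ∫ z : Space × Space, g z.1 * φ z.2 * heatKernel s (z.1 - z.2) ∂(volume.prod volume) =
      ∑ i, c i * ∫ y, g y * heatKernel (s + t) (X i - y) := by
    rw [gaussianForm_symm, hφg_val]
  -- `f = φ - g`
  set f : Space → ℝ := fun x => φ x - g x with hf
  have hfm : Measurable f := hφm.sub hgm
  have hfi : Integrable f := hφi.sub hg
  have h12 : Integrable (fun z : Space × Space =>
      φ z.1 * φ z.2 * heatKernel s (z.1 - z.2) - φ z.1 * g z.2 * heatKernel s (z.1 - z.2))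
      (volume.prod volume) := hφφ_int.sub hφg_int
  have h123 : Integrable (fun z : Space × Space =>
      φ z.1 * φ z.2 * heatKernel s (z.1 - z.2) - φ z.1 * g z.2 * heatKernel s (z.1 - z.2) -
        g z.1 * φ z.2 * heatKernel s (z.1 - z.2)) (volume.prod volume) := h12.sub hgφ_int
  have e1 : ∫ z : Space × Space, (φ z.1 * φ z.2 * heatKernel s (z.1 - z.2) -
      φ z.1 * g z.2 * heatKernel s (z.1 - z.2)) ∂(volume.prod volume) =
      (∫ z : Space × Space, φ z.1 * φ z.2 * heatKernel s (z.1 - z.2) ∂(volume.prod volume)) -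
        ∫ z : Space × Space, φ z.1 * g z.2 * heatKernel s (z.1 - z.2) ∂(volume.prod volume) :=
    integral_sub hφφ_int hφg_int
  have e2 : ∫ z : Space × Space, (φ z.1 * φ z.2 * heatKernel s (z.1 - z.2) -
      φ z.1 * g z.2 * heatKernel s (z.1 - z.2) - g z.1 * φ z.2 * heatKernel s (z.1 - z.2))
        ∂(volume.prod volume) =
      (∫ z : Space × Space, (φ z.1 * φ z.2 * heatKernel s (z.1 - z.2) -
        φ z.1 * g z.2 * heatKernel s (z.1 - z.2)) ∂(volume.prod volume)) -
        ∫ z : Space × Space, g z.1 * φ z.2 * heatKernel s (z.1 - z.2) ∂(volume.prod volume) :=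
    integral_sub h12 hgφ_int
  have e3 : ∫ z : Space × Space, (φ z.1 * φ z.2 * heatKernel s (z.1 - z.2) -
      φ z.1 * g z.2 * heatKernel s (z.1 - z.2) - g z.1 * φ z.2 * heatKernel s (z.1 - z.2) +
        g z.1 * g z.2 * heatKernel s (z.1 - z.2)) ∂(volume.prod volume) =
      (∫ z : Space × Space, (φ z.1 * φ z.2 * heatKernel s (z.1 - z.2) -
        φ z.1 * g z.2 * heatKernel s (z.1 - z.2) - g z.1 * φ z.2 * heatKernel s (z.1 - z.2))
          ∂(volume.prod volume)) +
        ∫ z : Space × Space, g z.1 * g z.2 * heatKernel s (z.1 - z.2) ∂(volume.prod volume) :=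
    integral_add h123 hgg_int
  have e4 : ∫ z : Space × Space, f z.1 * f z.2 * heatKernel s (z.1 - z.2) ∂(volume.prod volume) =
      ∫ z : Space × Space, (φ z.1 * φ z.2 * heatKernel s (z.1 - z.2) -
        φ z.1 * g z.2 * heatKernel s (z.1 - z.2) - g z.1 * φ z.2 * heatKernel s (z.1 - z.2) +
          g z.1 * g z.2 * heatKernel s (z.1 - z.2)) ∂(volume.prod volume) := by
    refine integral_congr_ae (Eventually.of_forall fun z => ?_)
    simp only [hf]
    ring
  have hpos := integral_prod_gaussian_nonneg hfm hfi hs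
  rw [e4, e3, e2, e1, hgφ_val, hφφ_val, hφg_val] at hpos
  linarith

/-- `u ↦ G_u(z)` is continuous at every `u > 0`. [folklore] -/
theorem continuousAt_heatKernel_left {u : ℝ} (hu : 0 < u) (z : Space) :
    ContinuousAt (fun v : ℝ => heatKernel v z) u := by
  have h : (fun v : ℝ => heatKernel v z) =
      fun v => (4 * π * v) ^ (-(3 / 2 : ℝ)) * Real.exp (-‖z‖ ^ 2 / (4 * v)) :=
    funext fun v => heatKernel_three v z
  rw [h]
  refine ContinuousAt.mul ?_ ?_
  · exact (continuousAt_const.mul continuousAt_id).rpow_const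
      (Or.inl (by positivity : (4 * π * u) ≠ 0))
  · exact (continuousAt_const.div (continuousAt_const.mul continuousAt_id)
      (by positivity : (4 * u) ≠ 0)).rexp

/-- `G_{s + kt}(z) → G_s(z)` as `t → 0⁺` (`s > 0`). [folklore] -/
theorem tendsto_heatKernel_add {s : ℝ} (hs : 0 < s) (k : ℝ) (z : Space) :
    Tendsto (fun t : ℝ => heatKernel (s + k * t) z) (𝓝[>] 0) (𝓝 (heatKernel s z)) := by
  have h1 : Tendsto (fun t : ℝ => s + k * t) (𝓝[>] (0 : ℝ)) (𝓝 s) := by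
    have : Tendsto (fun t : ℝ => s + k * t) (𝓝 0) (𝓝 (s + k * 0)) :=
      (continuous_const.add (continuous_const.mul continuous_id)).tendsto 0
    rw [mul_zero, add_zero] at this
    exact tendsto_nhdsWithin_of_tendsto_nhds this
  exact (continuousAt_heatKernel_left hs z).tendsto.comp h1

/-- Dominated convergence: `∫ g(y) G_{s+t}(a - y) dy → ∫ g(y) G_s(a - y) dy` as `t → 0⁺`, for
`g ∈ L¹(ℝ³)` and `s > 0` (bound `|g| (4πs)^{-3/2}`). [folklore] -/
theorem tendsto_integral_mul_heatKernel_add {s : ℝ} (hs : 0 < s) (a : Space) {g : Space → ℝ}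
    (hgm : Measurable g) (hg : Integrable g) :
    Tendsto (fun t : ℝ => ∫ y, g y * heatKernel (s + t) (a - y)) (𝓝[>] 0)
      (𝓝 (∫ y, g y * heatKernel s (a - y))) := by
  refine tendsto_integral_filter_of_dominated_convergence
    (fun y => ‖g y‖ * (4 * π * s) ^ (-(3 : ℝ) / 2)) ?_ ?_ (hg.norm.mul_const _) ?_
  · exact Eventually.of_forall fun t => (hgm.mul ((continuous_heatKernel _).measurable.comp
      (measurable_const.sub measurable_id))).aestronglyMeasurable
  · refine eventually_nhdsWithin_of_forall fun t ht => Eventually.of_forall fun y => ?_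
    have ht0 : (0 : ℝ) < t := ht
    rw [norm_mul, Real.norm_of_nonneg (heatKernel_pos (by linarith) _).le]
    refine mul_le_mul_of_nonneg_left ?_ (norm_nonneg _)
    calc heatKernel (s + t) (a - y) ≤ (4 * π * (s + t)) ^ (-(3 : ℝ) / 2) :=
          heatKernel_le_three (by linarith) _
      _ ≤ (4 * π * s) ^ (-(3 : ℝ) / 2) :=
          Real.rpow_le_rpow_of_nonpos (by positivity)
            (mul_le_mul_of_nonneg_left (by linarith) (by positivity)) (by norm_num)
  · refine Eventually.of_forall fun y => ?_
    have h := (tendsto_heatKernel_add hs 1 (a - y)).const_mul (g y)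
    simpa only [one_mul] using h

/-- **Point charges and background in a Gaussian kernel**: for charges `cᵢ ∈ ℝ` at `xᵢ ∈ ℝ³`
(not necessarily distinct), `s > 0` and a real measurable `g ∈ L¹(ℝ³)`,
`0 ≤ ∑ᵢ∑ⱼ cᵢcⱼ G_s(xᵢ - xⱼ) - 2∑ᵢ cᵢ ∫ g(y) G_s(xᵢ - y) dy + ∬ g(x) g(y) G_s(x - y) dx dy`
(`gaussianForm_clouds_nonneg` and `t → 0⁺`): the heat kernel is a kernel of positive type for
measures. [cite: LiebLoss2001, Thm. 9.8] -/
theorem gaussianForm_points_nonneg {N : ℕ} (c : Fin N → ℝ) (X : Fin N → Space) {s : ℝ}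
    (hs : 0 < s) {g : Space → ℝ} (hgm : Measurable g) (hg : Integrable g) :
    0 ≤ (∑ i, ∑ j, c i * c j * heatKernel s (X i - X j)) -
        2 * (∑ i, c i * ∫ y, g y * heatKernel s (X i - y)) +
        ∫ z : Space × Space, g z.1 * g z.2 * heatKernel s (z.1 - z.2) ∂(volume.prod volume) := by
  have hlim : Tendsto (fun t : ℝ => (∑ i, ∑ j, c i * c j * heatKernel (s + 2 * t) (X i - X j)) -
      2 * (∑ i, c i * ∫ y, g y * heatKernel (s + t) (X i - y)) +
      ∫ z : Space × Space, g z.1 * g z.2 * heatKernel s (z.1 - z.2) ∂(volume.prod volume))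
      (𝓝[>] 0) (𝓝 ((∑ i, ∑ j, c i * c j * heatKernel s (X i - X j)) -
        2 * (∑ i, c i * ∫ y, g y * heatKernel s (X i - y)) +
        ∫ z : Space × Space, g z.1 * g z.2 * heatKernel s (z.1 - z.2) ∂(volume.prod volume))) := by
    refine ((tendsto_finsetSum _ fun i _ => tendsto_finsetSum _ fun j _ =>
      (tendsto_heatKernel_add hs 2 (X i - X j)).const_mul (c i * c j)).sub
      ((tendsto_finsetSum _ fun i _ =>
        (tendsto_integral_mul_heatKernel_add hs (X i) hgm hg).const_mul (c i)).const_mul 2)).add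
      tendsto_const_nhds
  exact ge_of_tendsto hlim (eventually_nhdsWithin_of_forall fun t ht =>
    gaussianForm_clouds_nonneg c X hs ht hgm hg)

/-! ### Subordinated kernels `K_w(z) = ∫₀^∞ w(s) G_s(z) ds` of finite `K_w(0)` -/

/-- For a measurable weight `w ≥ 0` with `K_w(0) = ∫₀^∞ w(s) G_s(0) ds < ∞`, `s ↦ w(s) G_s(z)` is
integrable on `(0, ∞)` for every `z` (domination by `z = 0`). [folklore] -/
theorem integrableOn_weight_mul_heatKernel {w : ℝ → ℝ} (hwm : Measurable w)
    (hw0 : ∀ s, 0 < s → 0 ≤ w s)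
    (hK0 : IntegrableOn (fun s : ℝ => w s * heatKernel s (0 : Space)) (Ioi 0)) (z : Space) :
    IntegrableOn (fun s : ℝ => w s * heatKernel s z) (Ioi 0) := by
  refine hK0.mono' (hwm.mul (measurable_heatKernel_left z)).aestronglyMeasurable ?_
  refine (ae_restrict_iff' measurableSet_Ioi).2 (Eventually.of_forall fun s hs => ?_)
  have hs0 : (0 : ℝ) < s := hs
  rw [Real.norm_eq_abs, abs_mul, abs_of_nonneg (hw0 s hs0), abs_of_pos (heatKernel_pos hs0 _)]
  exact mul_le_mul_of_nonneg_left (heatKernel_le_heatKernel_zero hs0 z) (hw0 s hs0)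

/-- `0 ≤ K_w(z)`. [folklore] -/
theorem subordinatedKernel_nonneg' {w : ℝ → ℝ} (hw0 : ∀ s, 0 < s → 0 ≤ w s) (z : Space) :
    0 ≤ ∫ s in Ioi (0 : ℝ), w s * heatKernel s z :=
  setIntegral_nonneg measurableSet_Ioi fun s hs =>
    mul_nonneg (hw0 s hs) (heatKernel_pos (show (0 : ℝ) < s from hs) z).le

/-- `K_w(z) ≤ K_w(0)`. [folklore] -/
theorem subordinatedKernel_le_zero {w : ℝ → ℝ} (hwm : Measurable w) (hw0 : ∀ s, 0 < s → 0 ≤ w s)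
    (hK0 : IntegrableOn (fun s : ℝ => w s * heatKernel s (0 : Space)) (Ioi 0)) (z : Space) :
    ∫ s in Ioi (0 : ℝ), w s * heatKernel s z ≤ ∫ s in Ioi (0 : ℝ), w s * heatKernel s (0 : Space) :=
  setIntegral_mono_on (integrableOn_weight_mul_heatKernel hwm hw0 hK0 z) hK0 measurableSet_Ioi
    fun s hs => mul_le_mul_of_nonneg_left (heatKernel_le_heatKernel_zero hs z) (hw0 s hs)

/-- `K_w` is even. [folklore] -/
theorem subordinatedKernel_neg (w : ℝ → ℝ) (z : Space) :
    ∫ s in Ioi (0 : ℝ), w s * heatKernel s (-z) = ∫ s in Ioi (0 : ℝ), w s * heatKernel s z := by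
  simp_rw [heatKernel_neg]

/-- **Point charges and background in a subordinated kernel** [LiebSolovej2001, (4.3), mechanism]:
for a measurable weight `w ≥ 0` on `(0, ∞)` with `K_w(0) = ∫₀^∞ w(s) G_s(0) ds < ∞`, charges
`cᵢ ∈ ℝ` at points `xᵢ ∈ ℝ³` (not necessarily distinct) and a real measurable background
`g ∈ L¹(ℝ³)`, with `K_w(z) = ∫₀^∞ w(s) G_s(z) ds`:
`0 ≤ ∑ᵢ∑ⱼ cᵢcⱼ K_w(xᵢ - xⱼ) - 2∑ᵢ cᵢ ∫ g(y) K_w(xᵢ - y) dy + ∬ g(x) g(y) K_w(x - y) dx dy`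
(`gaussianForm_points_nonneg` integrated against `w(s) ds`; Fubini is justified by `K_w(0) < ∞`).
[cite: LiebSolovej2001, §4 (4.3)] -/
theorem subordinated_points_nonneg {w : ℝ → ℝ} (hwm : Measurable w) (hw0 : ∀ s, 0 < s → 0 ≤ w s)
    (hK0 : IntegrableOn (fun s : ℝ => w s * heatKernel s (0 : Space)) (Ioi 0))
    {N : ℕ} (c : Fin N → ℝ) (X : Fin N → Space) {g : Space → ℝ} (hgm : Measurable g)
    (hg : Integrable g) :
    0 ≤ (∑ i, ∑ j, c i * c j * ∫ s in Ioi (0 : ℝ), w s * heatKernel s (X i - X j)) -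
        2 * (∑ i, c i * ∫ y, g y * ∫ s in Ioi (0 : ℝ), w s * heatKernel s (X i - y)) +
        ∫ z : Space × Space, g z.1 * g z.2 * (∫ s in Ioi (0 : ℝ), w s * heatKernel s (z.1 - z.2))
          ∂(volume.prod volume) := by
  have hKi := integrableOn_weight_mul_heatKernel hwm hw0 hK0
  have hprod1 : (volume.restrict (Ioi (0 : ℝ))).prod (volume : Measure Space) =
      ((volume : Measure ℝ).prod (volume : Measure Space)).restrict (Ioi 0 ×ˢ univ) := by
    rw [← Measure.prod_restrict, Measure.restrict_univ]
  have hprod2 : (volume.restrict (Ioi (0 : ℝ))).prod (volume.prod volume : Measure (Space × Space)) =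
      ((volume : Measure ℝ).prod (volume.prod volume : Measure (Space × Space))).restrict
        (Ioi 0 ×ˢ univ) := by
    rw [← Measure.prod_restrict, Measure.restrict_univ]
  -- (i) the cloud–cloud terms
  have he1 : (fun s => w s * ∑ i, ∑ j, c i * c j * heatKernel s (X i - X j)) =
      fun s => ∑ i, ∑ j, c i * c j * (w s * heatKernel s (X i - X j)) := by
    funext s
    rw [Finset.mul_sum]
    refine Finset.sum_congr rfl fun i _ => ?_
    rw [Finset.mul_sum]
    refine Finset.sum_congr rfl fun j _ => ?_
    ring
  have h1 : ∫ s in Ioi (0 : ℝ), w s * ∑ i, ∑ j, c i * c j * heatKernel s (X i - X j) =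
      ∑ i, ∑ j, c i * c j * ∫ s in Ioi (0 : ℝ), w s * heatKernel s (X i - X j) := by
    rw [he1, integral_finsetSum _ (fun i _ => integrable_finsetSum _ fun j _ => (hKi _).const_mul _)]
    refine Finset.sum_congr rfl fun i _ => ?_
    rw [integral_finsetSum _ (fun j _ => (hKi _).const_mul _)]
    refine Finset.sum_congr rfl fun j _ => ?_
    exact integral_const_mul _ _
  have h1i : Integrable (fun s => w s * ∑ i, ∑ j, c i * c j * heatKernel s (X i - X j))
      (volume.restrict (Ioi 0)) := by
    rw [he1]
    exact integrable_finsetSum _ fun i _ => integrable_finsetSum _ fun j _ => (hKi _).const_mul _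
  -- (ii) the cloud–background terms: Fubini in `(s, y)`
  have hF2 : ∀ a : Space, Integrable (Function.uncurry fun (s : ℝ) (y : Space) =>
      w s * (g y * heatKernel s (a - y))) ((volume.restrict (Ioi 0)).prod volume) := by
    intro a
    have hm : Measurable (Function.uncurry fun (s : ℝ) (y : Space) =>
        w s * (g y * heatKernel s (a - y))) :=
      (hwm.comp measurable_fst).mul ((hgm.comp measurable_snd).mul
        (measurable_heatKernel_uncurry.comp (measurable_fst.prodMk (measurable_const.sub measurable_snd))))
    have hb : Integrable (fun q : ℝ × Space => (w q.1 * heatKernel q.1 (0 : Space)) * ‖g q.2‖)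
        ((volume.restrict (Ioi 0)).prod volume) := hK0.mul_prod hg.norm
    refine hb.mono' hm.aestronglyMeasurable ?_
    rw [hprod1]
    refine (ae_restrict_iff' (measurableSet_Ioi.prod MeasurableSet.univ)).2
      (Eventually.of_forall fun q hq => ?_)
    have hs0 : (0 : ℝ) < q.1 := hq.1
    show ‖w q.1 * (g q.2 * heatKernel q.1 (a - q.2))‖ ≤ w q.1 * heatKernel q.1 (0 : Space) * ‖g q.2‖
    rw [norm_mul, norm_mul, Real.norm_of_nonneg (hw0 _ hs0),
      Real.norm_of_nonneg (heatKernel_pos hs0 _).le]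
    calc w q.1 * (‖g q.2‖ * heatKernel q.1 (a - q.2)) ≤ w q.1 * (‖g q.2‖ * heatKernel q.1 (0 : Space)) :=
          mul_le_mul_of_nonneg_left (mul_le_mul_of_nonneg_left
            (heatKernel_le_heatKernel_zero hs0 _) (norm_nonneg _)) (hw0 _ hs0)
      _ = w q.1 * heatKernel q.1 (0 : Space) * ‖g q.2‖ := by ring
  have h2 : ∀ a : Space, ∫ s in Ioi (0 : ℝ), w s * ∫ y, g y * heatKernel s (a - y) =
      ∫ y, g y * ∫ s in Ioi (0 : ℝ), w s * heatKernel s (a - y) := by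
    intro a
    have e1 : ∫ s in Ioi (0 : ℝ), w s * ∫ y, g y * heatKernel s (a - y) =
        ∫ s in Ioi (0 : ℝ), ∫ y, w s * (g y * heatKernel s (a - y)) := by
      refine integral_congr_ae (Eventually.of_forall fun s => ?_)
      exact (integral_const_mul _ _).symm
    rw [e1, integral_integral_swap (hF2 a)]
    refine integral_congr_ae (Eventually.of_forall fun y => ?_)
    show ∫ s in Ioi (0 : ℝ), w s * (g y * heatKernel s (a - y)) =
      g y * ∫ s in Ioi (0 : ℝ), w s * heatKernel s (a - y)
    rw [← integral_const_mul]
    refine integral_congr_ae (Eventually.of_forall fun s => ?_)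
    ring
  have h2i : ∀ a : Space, Integrable (fun s => w s * ∫ y, g y * heatKernel s (a - y))
      (volume.restrict (Ioi 0)) := by
    intro a
    refine (hF2 a).integral_prod_left.congr (Eventually.of_forall fun s => ?_)
    show ∫ y, w s * (g y * heatKernel s (a - y)) = w s * ∫ y, g y * heatKernel s (a - y)
    exact integral_const_mul _ _
  -- (iii) the background–background term: Fubini in `(s, (x, y))`
  have hF3 : Integrable (Function.uncurry fun (s : ℝ) (z : Space × Space) =>
      w s * (g z.1 * g z.2 * heatKernel s (z.1 - z.2)))
      ((volume.restrict (Ioi 0)).prod (volume.prod volume)) := by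
    have hm : Measurable (Function.uncurry fun (s : ℝ) (z : Space × Space) =>
        w s * (g z.1 * g z.2 * heatKernel s (z.1 - z.2))) :=
      (hwm.comp measurable_fst).mul (((hgm.comp (measurable_fst.comp measurable_snd)).mul
        (hgm.comp (measurable_snd.comp measurable_snd))).mul
        (measurable_heatKernel_uncurry.comp (measurable_fst.prodMk
          ((measurable_fst.comp measurable_snd).sub (measurable_snd.comp measurable_snd)))))
    have hb : Integrable (fun q : ℝ × (Space × Space) =>
        (w q.1 * heatKernel q.1 (0 : Space)) * (‖g q.2.1‖ * ‖g q.2.2‖))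
        ((volume.restrict (Ioi 0)).prod (volume.prod volume)) :=
      hK0.mul_prod (hg.norm.mul_prod hg.norm)
    refine hb.mono' hm.aestronglyMeasurable ?_
    rw [hprod2]
    refine (ae_restrict_iff' (measurableSet_Ioi.prod MeasurableSet.univ)).2
      (Eventually.of_forall fun q hq => ?_)
    have hs0 : (0 : ℝ) < q.1 := hq.1
    show ‖w q.1 * (g q.2.1 * g q.2.2 * heatKernel q.1 (q.2.1 - q.2.2))‖ ≤
      w q.1 * heatKernel q.1 (0 : Space) * (‖g q.2.1‖ * ‖g q.2.2‖)
    rw [norm_mul, norm_mul, norm_mul, Real.norm_of_nonneg (hw0 _ hs0),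
      Real.norm_of_nonneg (heatKernel_pos hs0 _).le]
    calc w q.1 * (‖g q.2.1‖ * ‖g q.2.2‖ * heatKernel q.1 (q.2.1 - q.2.2))
        ≤ w q.1 * (‖g q.2.1‖ * ‖g q.2.2‖ * heatKernel q.1 (0 : Space)) :=
          mul_le_mul_of_nonneg_left (mul_le_mul_of_nonneg_left
            (heatKernel_le_heatKernel_zero hs0 _) (by positivity)) (hw0 _ hs0)
      _ = w q.1 * heatKernel q.1 (0 : Space) * (‖g q.2.1‖ * ‖g q.2.2‖) := by ring
  have h3 : ∫ s in Ioi (0 : ℝ), w s * ∫ z : Space × Space, g z.1 * g z.2 * heatKernel s (z.1 - z.2)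
        ∂(volume.prod volume) =
      ∫ z : Space × Space, g z.1 * g z.2 * (∫ s in Ioi (0 : ℝ), w s * heatKernel s (z.1 - z.2))
        ∂(volume.prod volume) := by
    have e1 : ∫ s in Ioi (0 : ℝ), w s * ∫ z : Space × Space, g z.1 * g z.2 * heatKernel s (z.1 - z.2)
          ∂(volume.prod volume) =
        ∫ s in Ioi (0 : ℝ), ∫ z : Space × Space, w s * (g z.1 * g z.2 * heatKernel s (z.1 - z.2))
          ∂(volume.prod volume) := by
      refine integral_congr_ae (Eventually.of_forall fun s => ?_)
      exact (integral_const_mul _ _).symm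
    rw [e1, integral_integral_swap hF3]
    refine integral_congr_ae (Eventually.of_forall fun z => ?_)
    show ∫ s in Ioi (0 : ℝ), w s * (g z.1 * g z.2 * heatKernel s (z.1 - z.2)) =
      g z.1 * g z.2 * ∫ s in Ioi (0 : ℝ), w s * heatKernel s (z.1 - z.2)
    rw [← integral_const_mul]
    refine integral_congr_ae (Eventually.of_forall fun s => ?_)
    ring
  have h3i : Integrable (fun s => w s * ∫ z : Space × Space, g z.1 * g z.2 * heatKernel s (z.1 - z.2)
      ∂(volume.prod volume)) (volume.restrict (Ioi 0)) := by
    refine hF3.integral_prod_left.congr (Eventually.of_forall fun s => ?_)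
    show ∫ z : Space × Space, w s * (g z.1 * g z.2 * heatKernel s (z.1 - z.2)) ∂(volume.prod volume) =
      w s * ∫ z : Space × Space, g z.1 * g z.2 * heatKernel s (z.1 - z.2) ∂(volume.prod volume)
    exact integral_const_mul _ _
  -- assemble: `0 ≤ ∫ w(s) Q(s) ds`
  have hQ : 0 ≤ ∫ s in Ioi (0 : ℝ), w s * ((∑ i, ∑ j, c i * c j * heatKernel s (X i - X j)) -
      2 * (∑ i, c i * ∫ y, g y * heatKernel s (X i - y)) +
      ∫ z : Space × Space, g z.1 * g z.2 * heatKernel s (z.1 - z.2) ∂(volume.prod volume)) :=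
    setIntegral_nonneg measurableSet_Ioi fun s hs =>
      mul_nonneg (hw0 s hs) (gaussianForm_points_nonneg c X hs hgm hg)
  have he2 : (fun s => w s * ∑ i, c i * ∫ y, g y * heatKernel s (X i - y)) =
      fun s => ∑ i, c i * (w s * ∫ y, g y * heatKernel s (X i - y)) := by
    funext s
    rw [Finset.mul_sum]
    refine Finset.sum_congr rfl fun i _ => ?_
    ring
  have h2s : ∫ s in Ioi (0 : ℝ), w s * ∑ i, c i * ∫ y, g y * heatKernel s (X i - y) =
      ∑ i, c i * ∫ y, g y * ∫ s in Ioi (0 : ℝ), w s * heatKernel s (X i - y) := by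
    rw [he2, integral_finsetSum _ (fun i _ => (h2i _).const_mul _)]
    refine Finset.sum_congr rfl fun i _ => ?_
    rw [integral_const_mul, h2 (X i)]
  have h2si : Integrable (fun s => w s * ∑ i, c i * ∫ y, g y * heatKernel s (X i - y))
      (volume.restrict (Ioi 0)) := by
    rw [he2]
    exact integrable_finsetSum _ fun i _ => (h2i _).const_mul _
  have hI2 : Integrable (fun s => 2 * (w s * ∑ i, c i * ∫ y, g y * heatKernel s (X i - y)))
      (volume.restrict (Ioi 0)) := h2si.const_mul 2
  have hI12 : Integrable (fun s => w s * ∑ i, ∑ j, c i * c j * heatKernel s (X i - X j) -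
      2 * (w s * ∑ i, c i * ∫ y, g y * heatKernel s (X i - y))) (volume.restrict (Ioi 0)) :=
    h1i.sub hI2
  have eA : ∫ s in Ioi (0 : ℝ), (w s * ∑ i, ∑ j, c i * c j * heatKernel s (X i - X j) -
      2 * (w s * ∑ i, c i * ∫ y, g y * heatKernel s (X i - y)) +
      w s * ∫ z : Space × Space, g z.1 * g z.2 * heatKernel s (z.1 - z.2) ∂(volume.prod volume)) =
      (∫ s in Ioi (0 : ℝ), (w s * ∑ i, ∑ j, c i * c j * heatKernel s (X i - X j) -
        2 * (w s * ∑ i, c i * ∫ y, g y * heatKernel s (X i - y)))) +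
      ∫ s in Ioi (0 : ℝ), w s * ∫ z : Space × Space, g z.1 * g z.2 * heatKernel s (z.1 - z.2)
        ∂(volume.prod volume) := integral_add hI12 h3i
  have eB : ∫ s in Ioi (0 : ℝ), (w s * ∑ i, ∑ j, c i * c j * heatKernel s (X i - X j) -
      2 * (w s * ∑ i, c i * ∫ y, g y * heatKernel s (X i - y))) =
      (∫ s in Ioi (0 : ℝ), w s * ∑ i, ∑ j, c i * c j * heatKernel s (X i - X j)) -
      ∫ s in Ioi (0 : ℝ), 2 * (w s * ∑ i, c i * ∫ y, g y * heatKernel s (X i - y)) :=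
    integral_sub h1i hI2
  have eC : ∫ s in Ioi (0 : ℝ), 2 * (w s * ∑ i, c i * ∫ y, g y * heatKernel s (X i - y)) =
      2 * ∫ s in Ioi (0 : ℝ), w s * ∑ i, c i * ∫ y, g y * heatKernel s (X i - y) :=
    integral_const_mul _ _
  have he : (fun s => w s * ((∑ i, ∑ j, c i * c j * heatKernel s (X i - X j)) -
      2 * (∑ i, c i * ∫ y, g y * heatKernel s (X i - y)) +
      ∫ z : Space × Space, g z.1 * g z.2 * heatKernel s (z.1 - z.2) ∂(volume.prod volume))) =
      fun s => (w s * ∑ i, ∑ j, c i * c j * heatKernel s (X i - X j) -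
        2 * (w s * ∑ i, c i * ∫ y, g y * heatKernel s (X i - y))) +
        w s * ∫ z : Space × Space, g z.1 * g z.2 * heatKernel s (z.1 - z.2) ∂(volume.prod volume) := by
    funext s
    ring
  rw [he, eA, eB, eC, h1, h2s, h3] at hQ
  exact hQ

/-- **`U_K ≥ -½ K(0) ∑ cᵢ²` for positive-type subordinated kernels** [LiebSolovej2001, (4.3)]:
under the hypotheses of `subordinated_points_nonneg`, with `K_w(z) = ∫₀^∞ w(s) G_s(z) ds`,
`-½ K_w(0) ∑ᵢ cᵢ² ≤ ∑_{i<j} cᵢcⱼ K_w(xᵢ - xⱼ) - ∑ᵢ cᵢ ∫ g(y) K_w(xᵢ - y) dy + ½ ∬ g(x)g(y)K_w(x - y)`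
(split the double sum into its diagonal `K_w(0) ∑ cᵢ²` and twice the upper triangle). This is how
the long-distance cutoff `Y_{ω/ℓ} ↦ Y_{R⁻¹}` costs at most `½ n (Y_{ω/ℓ} - Y_{R⁻¹})(0) ≤ ½ n R⁻¹`
in [LiebSolovej2001, Lemma 4.1]. [cite: LiebSolovej2001, §4 (4.3)] -/
theorem subordinated_points_ge {w : ℝ → ℝ} (hwm : Measurable w) (hw0 : ∀ s, 0 < s → 0 ≤ w s)
    (hK0 : IntegrableOn (fun s : ℝ => w s * heatKernel s (0 : Space)) (Ioi 0))
    {N : ℕ} (c : Fin N → ℝ) (X : Fin N → Space) {g : Space → ℝ} (hgm : Measurable g)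
    (hg : Integrable g) :
    -(1 / 2 * (∫ s in Ioi (0 : ℝ), w s * heatKernel s (0 : Space)) * ∑ i, c i ^ 2) ≤
      (∑ i, ∑ j with i < j, c i * c j * ∫ s in Ioi (0 : ℝ), w s * heatKernel s (X i - X j)) -
        (∑ i, c i * ∫ y, g y * ∫ s in Ioi (0 : ℝ), w s * heatKernel s (X i - y)) +
        1 / 2 * ∫ z : Space × Space, g z.1 * g z.2 *
          (∫ s in Ioi (0 : ℝ), w s * heatKernel s (z.1 - z.2)) ∂(volume.prod volume) := by
  have h0 := subordinated_points_nonneg hwm hw0 hK0 c X hgm hg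
  set a : Fin N → Fin N → ℝ := fun i j => c i * c j * ∫ s in Ioi (0 : ℝ), w s * heatKernel s (X i - X j)
    with ha
  have hsymm : ∀ i j, a i j = a j i := fun i j => by
    simp only [ha]
    rw [← neg_sub (X i) (X j), subordinatedKernel_neg]
    ring
  have hdiag : ∑ i, a i i = (∫ s in Ioi (0 : ℝ), w s * heatKernel s (0 : Space)) * ∑ i, c i ^ 2 := by
    rw [Finset.mul_sum]
    refine Finset.sum_congr rfl fun i _ => ?_
    simp only [ha, sub_self]
    ring
  have hsplit := sum_sum_eq_diag_add_two_mul a hsymm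
  rw [hsplit, hdiag] at h0
  linarith

end Literature.MathematicalPhysics.QuantumManyBody.Coulomb
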